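import Summits.QuantumFields.BalabanUV.Beta.FP.RelInvPeriodised

/-!
# `BalabanUV.Beta.FP.RelInvPeriodisedSliced` — road «FP» (binder row D1), RULING R-FP-51 row **(T-INV)**, the torus half DRESSED:
# **(T-INV-per) IN THE CONSUMER'S `kOff` ∕ `kBig` ∕ `kkt` CURRENCY, PRESENTATION-GENERIC** — for ANY injective presentation of the live
# slots (non-comb fine bonds ⊕ coarse multipliers) and ANY presentation of the dead fine bonds, at EVERY step `j`, on every torus box `M`
# with `Lc ∣ M_i`: the compressed periodised candidate bordered Hessian `kOff` has a unit determinant, its inverse IS the live block of the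
# periodised co-dressed resolvent, the road's SLICED KKT `kkt H₀ [Q₁₀; τ₁]` (`τ₁` = coordinate rows of the comb bonds) is non-degenerate,
# and the live corner of its inverse is read off the periodised co-dressed resolvent (signs displayed)

HONEST DEPENDENCY (page 1, mandatory): continuum YM on T⁴ ⇐ BetaPertH ∧ nine spine estimates (0/9 proved); BetaPertH ⇐ (D1) ∧ (D4) ∧
CAP+tail; G-an2-4 gates asym, D1 and NE2/3/4.  HONEST FRAMING (cell contract, verbatim): «discharging `BetaPertH` makes Bałaban's UV
stability UNCONDITIONAL — a real constructive-QFT result; it is NOT the continuum limit and NOT the Clay problem.»  THIS MODULE is [folklore]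
bookkeeping BY NAME over: leaf-05's `RelInvPeriodised` (the four matrix rules on the torus box, `compress_of_rules`), leaf-03's
`RelInvCompression` (`kkt_fromRows_coordSlice_eq_kBig`), cap3's tree pinning `SaddleInverse.isUnit_det_kBig_iff ∕ inv_kBig_apply`, gan24-p3's
`KernelPeriodisationFib` (`perF_apply`, `perF_transpose`), an2's entry lemmas of `bhKAt ∕ bhKStepAt`, Mathlib block matrices.
It mints no `Prop`, has no `def`, cites nothing, 0 sorry.
ABSOLUTE RULE (cell charter, verbatim): «No internally-minted statement may enter as a cited fact. Every hypothesis is either kernel-proved in this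
package or a verbatim quotation of a PUBLISHED theorem with page reference. The manuscript(s) under audit are NOT citable for their own disputed
steps — they are the thing under adjudication; programme-internal (2001/route/tribunal) claims are never citable.»

CONTENT.  §1 (generic linear algebra): `kkt_submatrix_equiv` ∕ `det_kkt_submatrix_equiv` (re-indexing fields and conditions), **`kkt_fromRows_mul_mul` ∕
`det_kkt_fromRows_mul_mul` ∕ `det_kkt_fromRows_mul_slice`** (recombining the averaging rows by `S` and the slice rows by `T` conjugates the sliced KKT by
`diag(1,S,T)`: `det` scales by `(det S · det T)²` — rescaled averaging rows and signed ∕ permuted comb rows reduce to the rows as they sit ∕ coordinate rows), `kOff_neg_left` ∕ `det_kOff_neg_left` ∕ `isUnit_det_kOff_neg_left_iff` ∕ `fromBlocks_one_neg_one_eq_diagonal` ∕ `inv_kOff_neg_left_apply` (the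
torus bordered Hessian carries its top border with the sign `−Qᵀ`; passing to the symmetric `kkt` placement costs `(−1)^{#c}` on `det` and a sign on the
multiplier rows of the inverse), **`compress_of_rules_embedding`** (`RelInvPeriodised.compress_of_rules` transported along an injective presentation
`f : κ → ι` of the live set: `IsUnit (M̂∘f).det`, `(M̂∘f)⁻¹ = Â∘f`, `Â` vanishes off `range f × range f`).  §2 (torus entries, every `j`): `bhKStepAt_inr_inr`,
`bhKStepAt_inl_inr_eq_neg` (border antisymmetry, `rfl` + `ring`), `perF_bhKStepAt_inr_inr` (the periodised multiplier–multiplier block vanishes),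
`perF_bhKStepAt_inl_inr_eq_neg` (the periodised borders are negative-transposed: `perF_transpose` + `bhKStepAt_translate_invariant`).  §3 (the dress):
**`torus_kOff`** (live presentation `f : o ⊕ c ↪ Idx M (Fib d)`, range = the `axEc`-live set, `c`-slots multipliers ⇒ `IsUnit (kOff Aoo Aoc Aco).det`,
`(kOff …)⁻¹ = Â.submatrix f f`, `Â` supported on live × live), **`torus_sliced_kkt`** (add ANY dead presentation `g : t → Idx`; `o`-slots fields ⇒ the
symmetric sliced KKT `kkt [[Aoo,Aot],[Ato,Att]] [[Co,Ct];[0,1]]` with `Co := Aco`, `Ct := A_cg` has a unit determinant and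
`(kkt …)⁻¹ (live x, live y) = ±Â (f x) (f y)`, `+` on fields, `−` on multipliers), and the SLOT-MAP form **`torus_isUnit_det_kkt_of_slots`** (fine bonds
presented by `fν`, coarse multipliers by `fμ`, the comb by an injective `cb : ρ₁ → ν`: `kkt (M̂∘fν) [M̂∘(fμ,fν); τ₁]`, `τ₁ x b = [b = cb x]` (leaf-06's
`combRowsT` ∕ `combBondT` read in `ν`), has a unit determinant) — the shape of binder `h1` of `NestedStepLawOneShot.secondVar_oneShot_nestedStepLaw`, up to
the consumer's `T`-recombination of the comb rows and re-indexing (§1).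
WHAT IT IS FOR ∕ NOT: the (INV) letter of route T's (T-INST-j) integration theorem for the FINE sliced system at every level `j`, for whichever slot
presentation the torus instance chooses; the COARSE sliced system `kkt (𝔊₁₁ + G₀) [Q₂₀;τ₂]` (binder `h2`) is the level-raising reading and is NOT here.
Discharges NO binder of row D1 by itself; NOT (T-ID), NOT SDF, NOT D1, NOT BetaPertH, NOT continuum, NOT Clay.  Unit `b2b-balaban-beta-d1-formalise-leaf-05` (gen 24), 2026-08-21.
-/

noncomputable section

open scoped BigOperators Matrix

namespace Summit.QuantumFields.BalabanUV.Beta.FP.RelInvPeriodisedSliced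

open Matrix
open Literature.Probability.LatticeModels (Torus.proj)
open Literature.MathematicalPhysics.QuantumFieldTheory.Balaban1983to89
open Literature.MathematicalPhysics.QuantumFieldTheory.Balaban1983to89.Beta
open Literature.MathematicalPhysics.QuantumFieldTheory.Balaban1983to89.Beta.Composition (kkt)
open B4TorusKernel.MultiPeriod (translate)
open ExpKernelCalculus (MKer)
open AffineAveraging (box toSite)
open OneStepResolventKernel (Fib)
open OneStepKernelFamily (KInvStep)
open Summit.QuantumFields.BalabanUV.Beta.AxialDressingRooted (coDressKBmAt axEc)
open Summit.QuantumFields.BalabanUV.Beta.BorderedHessian (bhKAt bhKAt_inl_inr bhKAt_inr_inl bhKAt_inr_inr bhKStepAt bhKStepAt_zero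
  bhKStepAt_succ_fm bhKStepAt_succ_mf bhKStepAt_succ_mm)
open Summit.QuantumFields.BalabanUV.Beta.SaddleInverse (kBig kOff regroup isUnit_det_kBig_iff inv_kBig_apply)
open Summit.QuantumFields.BalabanUV.Beta.FP.KernelPeriodisationFib (Idx perF perF_apply perZ_apply trF perF_transpose)
open Summit.QuantumFields.BalabanUV.Beta.FP.RelInvPeriodised (compress_of_rules perF_axEc perF_rules_wall axEc_diag_zero_or_one
  bhKStepAt_translate_invariant)
open Summit.QuantumFields.BalabanUV.Beta.FP.RelInvCompression (kkt_fromRows_coordSlice_eq_kBig)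

/-! ## §1 Generic linear algebra: re-indexing, slice recombination, the border sign, compression along an embedding -/

section Generic

variable {𝕜 : Type*} [Field 𝕜]
variable {ν ν' μ μ' ρ : Type*} [Fintype ν] [Fintype ν'] [Fintype μ] [Fintype μ'] [Fintype ρ]
  [DecidableEq ν] [DecidableEq ν'] [DecidableEq μ] [DecidableEq μ'] [DecidableEq ρ]

omit [Fintype ν] [Fintype ν'] [Fintype μ] [Fintype μ'] [DecidableEq ν] [DecidableEq ν'] [DecidableEq μ] [DecidableEq μ'] in
/-- [folklore] Re-indexing the fields along `eν` and the conditions along `eμ` re-indexes the bordered matrix along `eν ⊕ eμ`. -/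
theorem kkt_submatrix_equiv (H : Matrix ν ν 𝕜) (Q : Matrix μ ν 𝕜) (eν : ν' ≃ ν) (eμ : μ' ≃ μ) :
    kkt (H.submatrix eν eν) (Q.submatrix eμ eν) = (kkt H Q).submatrix (Sum.map eν eμ) (Sum.map eν eμ) := by
  ext (i | i) (j | j) <;> rfl

/-- [folklore] … hence has the same determinant. -/
theorem det_kkt_submatrix_equiv (H : Matrix ν ν 𝕜) (Q : Matrix μ ν 𝕜) (eν : ν' ≃ ν) (eμ : μ' ≃ μ) :
    (kkt (H.submatrix eν eν) (Q.submatrix eμ eν)).det = (kkt H Q).det := by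
  rw [kkt_submatrix_equiv]
  exact Matrix.det_submatrix_equiv_self (Equiv.sumCongr eν eμ) (kkt H Q)

omit [DecidableEq μ] [DecidableEq ρ] in
/-- [folklore] **RECOMBINING THE AVERAGING ROWS BY `S` AND THE SLICE ROWS BY `T` CONJUGATES THE SLICED KKT**:
`kkt H [S·Q; T·τ] = diag(1,S,T) · kkt H [Q; τ] · diag(1,S,T)ᵀ`. -/
theorem kkt_fromRows_mul_mul (H : Matrix ν ν 𝕜) (Q : Matrix μ ν 𝕜) (τ : Matrix ρ ν 𝕜) (S : Matrix μ μ 𝕜) (T : Matrix ρ ρ 𝕜) :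
    kkt H (fromRows (S * Q) (T * τ))
      = fromBlocks (1 : Matrix ν ν 𝕜) 0 0 (fromBlocks S 0 0 T) * kkt H (fromRows Q τ) * (fromBlocks (1 : Matrix ν ν 𝕜) 0 0 (fromBlocks S 0 0 T))ᵀ := by
  have hD : fromBlocks S 0 0 T * fromRows Q τ = fromRows (S * Q) (T * τ) := by
    rw [fromBlocks_mul_fromRows, Matrix.zero_mul, Matrix.zero_mul, add_zero, zero_add]
  rw [← hD]
  simp only [kkt, fromBlocks_transpose, fromBlocks_multiply, transpose_mul, transpose_one, transpose_zero, Matrix.one_mul,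
    Matrix.mul_one, Matrix.zero_mul, Matrix.mul_zero, add_zero, zero_add]

/-- [folklore] **`det kkt H [S·Q; T·τ] = (det S · det T)² · det kkt H [Q; τ]`** — rescaled averaging rows (e.g. the border scale `stepScale`) and
signed ∕ permuted ∕ recombined comb-coordinate rows change the sliced determinant by a displayed non-zero factor only. -/
theorem det_kkt_fromRows_mul_mul (H : Matrix ν ν 𝕜) (Q : Matrix μ ν 𝕜) (τ : Matrix ρ ν 𝕜) (S : Matrix μ μ 𝕜) (T : Matrix ρ ρ 𝕜) :
    (kkt H (fromRows (S * Q) (T * τ))).det = (S.det * T.det) ^ 2 * (kkt H (fromRows Q τ)).det := by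
  rw [kkt_fromRows_mul_mul]
  simp only [det_mul, det_transpose, det_fromBlocks_zero₂₁, det_one, one_mul]
  ring

/-- [folklore] `det kkt H [Q; T·τ] = (det T)² · det kkt H [Q; τ]` (slice rows only). -/
theorem det_kkt_fromRows_mul_slice (H : Matrix ν ν 𝕜) (Q : Matrix μ ν 𝕜) (τ : Matrix ρ ν 𝕜) (T : Matrix ρ ρ 𝕜) :
    (kkt H (fromRows Q (T * τ))).det = T.det ^ 2 * (kkt H (fromRows Q τ)).det := by
  simpa only [Matrix.one_mul, det_one, one_mul] using det_kkt_fromRows_mul_mul H Q τ (1 : Matrix μ μ 𝕜) T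
end Generic

section Sign

variable {R : Type*} [CommRing R]
variable {o c : Type*} [Fintype o] [Fintype c] [DecidableEq o] [DecidableEq c]

/-- [folklore] Flipping the sign of the top border is a column sign change on the multiplier block: `kOff A (−B) C = kOff A B C · diag(1, −1)`. -/
theorem kOff_neg_left (A : Matrix o o R) (B : Matrix o c R) (C : Matrix c o R) :
    kOff A (-B) C = kOff A B C * fromBlocks (1 : Matrix o o R) 0 0 (-1 : Matrix c c R) := by
  rw [kOff, kOff, fromBlocks_multiply]
  simp only [Matrix.mul_one, Matrix.mul_zero, add_zero, zero_add, Matrix.mul_neg, neg_zero]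

/-- [folklore] `det (kOff A (−B) C) = (−1)^{#c} · det (kOff A B C)`. -/
theorem det_kOff_neg_left (A : Matrix o o R) (B : Matrix o c R) (C : Matrix c o R) :
    (kOff A (-B) C).det = (-1) ^ Fintype.card c * (kOff A B C).det := by
  rw [kOff_neg_left, det_mul, det_fromBlocks_zero₂₁, det_one, one_mul, det_neg, det_one, mul_one, mul_comm]

/-- [folklore] Hence `kOff A (−B) C` has a unit determinant iff `kOff A B C` has. -/
theorem isUnit_det_kOff_neg_left_iff (A : Matrix o o R) (B : Matrix o c R) (C : Matrix c o R) :
    IsUnit (kOff A (-B) C).det ↔ IsUnit (kOff A B C).det := by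
  rw [det_kOff_neg_left, IsUnit.mul_iff, and_iff_right]
  exact (isUnit_one.neg).pow _

omit [Fintype o] [Fintype c] in
/-- [folklore] `fromBlocks 1 0 0 (−1)` is the diagonal sign matrix `diag(ε)`, `ε = +1` on `o`, `−1` on `c`. -/
theorem fromBlocks_one_neg_one_eq_diagonal :
    fromBlocks (1 : Matrix o o R) 0 0 (-1 : Matrix c c R) = Matrix.diagonal (Sum.elim (fun _ => (1 : R)) fun _ => -1) := by
  rw [← Matrix.diagonal_one, ← Matrix.diagonal_one, Matrix.diagonal_neg, fromBlocks_diagonal]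

/-- [folklore] … and the inverse picks up the sign on its MULTIPLIER ROWS: `(kOff A (−B) C)⁻¹ x y = ε(x) · (kOff A B C)⁻¹ x y`, `ε = +1` on `o`,
`−1` on `c`. -/
theorem inv_kOff_neg_left_apply (A : Matrix o o R) (B : Matrix o c R) (C : Matrix c o R) (h : IsUnit (kOff A B C).det) (x y : o ⊕ c) :
    (kOff A (-B) C)⁻¹ x y = Sum.elim (fun _ => (1 : R)) (fun _ => -1) x * (kOff A B C)⁻¹ x y := by
  have hJ : fromBlocks (1 : Matrix o o R) 0 0 (-1 : Matrix c c R) * fromBlocks (1 : Matrix o o R) 0 0 (-1 : Matrix c c R) = 1 := by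
    rw [fromBlocks_multiply]
    simp only [Matrix.mul_one, Matrix.mul_zero, add_zero, zero_add, Matrix.mul_neg, neg_neg, neg_zero, fromBlocks_one]
  have hinv : (kOff A (-B) C)⁻¹ = fromBlocks (1 : Matrix o o R) 0 0 (-1 : Matrix c c R) * (kOff A B C)⁻¹ := by
    refine Matrix.inv_eq_right_inv ?_
    rw [kOff_neg_left, Matrix.mul_assoc, ← Matrix.mul_assoc (fromBlocks 1 0 0 (-1)), hJ, Matrix.one_mul, Matrix.mul_nonsing_inv _ h]
  rw [hinv, fromBlocks_one_neg_one_eq_diagonal, Matrix.diagonal_mul]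
end Sign

section Embedding

variable {ι κ : Type*} [Fintype ι] [DecidableEq ι] [Fintype κ] [DecidableEq κ]

/-- [folklore] **COMPRESSION ALONG AN EMBEDDING OF THE LIVE SET.**  Under the four matrix rules for the diagonal indicator `E` of `P`, and for an
injective presentation `f : κ → ι` of the live set (`P i ↔ i ∈ range f`): the presented live block `M̂.submatrix f f` has a unit determinant,
its inverse is `Â.submatrix f f`, and `Â` vanishes off live × live (`RelInvPeriodised.compress_of_rules` transported along
`κ ≃ {i // P i}`). -/
theorem compress_of_rules_embedding (P : ι → Prop) [DecidablePred P] (f : κ → ι) (hf : Function.Injective f)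
    (hPf : ∀ i, P i ↔ i ∈ Set.range f) {A Mh E : Matrix ι ι ℝ}
    (hE : E = Matrix.diagonal fun i => if P i then (1 : ℝ) else 0)
    (h1 : E * A = A) (h2 : A * E = A) (h3 : A * Mh * E = E) (h4 : E * Mh * A = E) :
    IsUnit (Mh.submatrix f f).det ∧ (Mh.submatrix f f)⁻¹ = A.submatrix f f ∧ ∀ i j, ¬ (P i ∧ P j) → A i j = 0 := by
  obtain ⟨hU, hI, -⟩ := compress_of_rules P hE h1 h2 h3 h4
  -- the presented live index `κ ≃ {i // P i}`, `f = val ∘ g`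
  let g : κ ≃ {i // P i} := (Equiv.ofInjective f hf).trans (Equiv.subtypeEquivRight fun i => (hPf i).symm)
  have hg : ∀ k, ((g k : {i // P i}) : ι) = f k := fun k => rfl
  have hblk : ∀ X : Matrix ι ι ℝ, (X.submatrix (Equiv.sumCompl P) (Equiv.sumCompl P)).toBlocks₁₁
      = X.submatrix (fun i : {i // P i} => (i : ι)) (fun i : {i // P i} => (i : ι)) := by
    intro X; ext i j; simp only [toBlocks₁₁, of_apply, submatrix_apply, Equiv.sumCompl_apply_inl]
  have hsub : ∀ X : Matrix ι ι ℝ, X.submatrix f f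
      = (X.submatrix (fun i : {i // P i} => (i : ι)) (fun i : {i // P i} => (i : ι))).submatrix g g := by
    intro X; ext k l; simp only [submatrix_apply, hg]
  rw [hblk, hblk] at hI
  rw [hblk] at hU
  refine ⟨?_, ?_, fun i j hij => ?_⟩
  · rw [hsub, Matrix.det_submatrix_equiv_self]; exact hU
  · rw [hsub, hsub, Matrix.inv_submatrix_equiv, hI]
  · -- off live × live, `A` vanishes: `A = E·A = A·E` with `E` the diagonal indicator of the live set
    by_cases hi : P i
    · have hj : ¬ P j := fun hj => hij ⟨hi, hj⟩
      have e := congrFun (congrFun h2 i) j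
      rw [hE, Matrix.mul_diagonal, if_neg hj, mul_zero] at e
      exact e.symm
    · have e := congrFun (congrFun h1 i) j
      rw [hE, Matrix.diagonal_mul, if_neg hi, zero_mul] at e
      exact e.symm
end Embedding

/-! ## §2 Torus entries of the periodised candidate bordered Hessian: zero multiplier block, negative-transposed borders (every `j`) -/

section Entries

variable {d : ℕ} (ρ : Fin (d + 1) → ℤ) (Lc : ℕ) [NeZero Lc]

/-- [folklore] The multiplier–multiplier entries of `bhKStepAt` vanish at every level. -/
theorem bhKStepAt_inr_inr : ∀ (j : ℕ) (x y : Fin (d + 1) → ℤ) (κ l : Fin (d + 1)), bhKStepAt d ρ Lc j x y (Sum.inr κ) (Sum.inr l) = 0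
  | 0, x, y, κ, l => by rw [bhKStepAt_zero, bhKAt_inr_inr]
  | j + 1, x, y, κ, l => bhKStepAt_succ_mm (d := d) (ρ := ρ) (Lc := Lc) j x y κ l

/-- [folklore] **BORDER ANTISYMMETRY** at every level: `bhKStepAt x y (inl κ) (inr l) = − bhKStepAt y x (inr l) (inl κ)` (entries `rfl`). -/
theorem bhKStepAt_inl_inr_eq_neg : ∀ (j : ℕ) (x y : Fin (d + 1) → ℤ) (κ l : Fin (d + 1)),
    bhKStepAt d ρ Lc j x y (Sum.inl κ) (Sum.inr l) = -bhKStepAt d ρ Lc j y x (Sum.inr l) (Sum.inl κ)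
  | 0, x, y, κ, l => by
    rw [bhKStepAt_zero, bhKAt_inl_inr, bhKAt_inr_inl]
    split_ifs <;> ring
  | j + 1, x, y, κ, l => by
    rw [bhKStepAt_succ_fm, bhKStepAt_succ_mf, bhKAt_inl_inr, bhKAt_inr_inl]
    split_ifs <;> ring

variable (M : Fin (d + 1) → ℕ)

/-- [folklore] **THE PERIODISED MULTIPLIER–MULTIPLIER BLOCK VANISHES** (every `j`, every box; a period sum of zeros). -/
theorem perF_bhKStepAt_inr_inr (j : ℕ) (p q : Idx M (Fib d)) {κ l : Fin (d + 1)} (hp : p.2 = Sum.inr κ) (hq : q.2 = Sum.inr l) :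
    perF M (bhKStepAt d ρ Lc j) p q = 0 := by
  rw [perF_apply, perZ_apply, hp, hq]
  simp only [bhKStepAt_inr_inr, tsum_zero]

/-- [folklore] **THE PERIODISED BORDERS ARE NEGATIVE-TRANSPOSED** (every `j`, every box `M` with `Lc ∣ M_i`): `M̂ (p, inl κ) (q, inr l) = − M̂ (q, inr l) (p, inl κ)`
(`perF_transpose` for the `Mℤ^{d+1}`-invariant step kernel, then the entrywise antisymmetry under the period sum). -/
theorem perF_bhKStepAt_inl_inr_eq_neg (hM : ∀ i, Lc ∣ M i) (j : ℕ) (p q : Idx M (Fib d)) {κ l : Fin (d + 1)}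
    (hp : p.2 = Sum.inl κ) (hq : q.2 = Sum.inr l) :
    perF M (bhKStepAt d ρ Lc j) p q = -perF M (bhKStepAt d ρ Lc j) q p := by
  have hT := perF_transpose M (K := bhKStepAt d ρ Lc j) fun m x y a b => bhKStepAt_translate_invariant ρ Lc j M hM m x y a b
  have hqp : perF M (bhKStepAt d ρ Lc j) q p = perF M (trF (bhKStepAt d ρ Lc j)) p q := by rw [hT, transpose_apply]
  rw [hqp, perF_apply, perF_apply, perZ_apply, perZ_apply, hp, hq, ← tsum_neg]
  refine tsum_congr fun m => ?_
  exact bhKStepAt_inl_inr_eq_neg ρ Lc j _ _ κ l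

end Entries

/-! ## §3 The dress: (T-INV) on the torus in `kOff` ∕ `kBig` ∕ `kkt` currency, for any presentation of the slots -/

section Dress

variable {d : ℕ} {Lc : ℕ} [NeZero Lc] {r : Fin (d + 1) → ℕ} (M : Fin (d + 1) → ℕ) [∀ μ, NeZero (M μ)]

/-- **[folklore] (T-INV) ON THE TORUS, `kOff` FORM — EVERY STEP `j`, ANY LIVE PRESENTATION.**  Let `f : o ⊕ c → Idx M (Fib d)` be injective with range
the LIVE set of `axEc (toSite r) Lc` (non-comb fine bonds ⊕ coarse multipliers; `hlive`) and with the `c`-slots multiplier slots (`hc`).  Then, with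
`M̂ := perF M (bhKStepAt d ρ Lc j)`, `Â := perF M (Π̂ᵀ(KInvStep Lc j)Π̂)`, `ρ = toSite r`: the compressed bordered Hessian
`kOff (M̂∘(f inl, f inl)) (M̂∘(f inl, f inr)) (M̂∘(f inr, f inl))` has a unit determinant, its inverse is `Â.submatrix f f`, and `Â` vanishes off
live × live. -/
theorem torus_kOff (hr : r ∈ box (d + 1) Lc) (hM : ∀ i, Lc ∣ M i) (j : ℕ)
    {o c : Type*} [Fintype o] [Fintype c] [DecidableEq o] [DecidableEq c]
    (f : o ⊕ c → Idx M (Fib d)) (hf : Function.Injective f)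
    (hlive : ∀ p : Idx M (Fib d), axEc (toSite r) Lc p.1 p.1 p.2 p.2 = 1 ↔ p ∈ Set.range f)
    (hc : ∀ a : c, ∃ m : Fin (d + 1), (f (Sum.inr a)).2 = Sum.inr m) :
    IsUnit (kOff ((perF M (bhKStepAt d (toSite r) Lc j)).submatrix (f ∘ Sum.inl) (f ∘ Sum.inl))
        ((perF M (bhKStepAt d (toSite r) Lc j)).submatrix (f ∘ Sum.inl) (f ∘ Sum.inr))
        ((perF M (bhKStepAt d (toSite r) Lc j)).submatrix (f ∘ Sum.inr) (f ∘ Sum.inl))).det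
      ∧ (kOff ((perF M (bhKStepAt d (toSite r) Lc j)).submatrix (f ∘ Sum.inl) (f ∘ Sum.inl))
          ((perF M (bhKStepAt d (toSite r) Lc j)).submatrix (f ∘ Sum.inl) (f ∘ Sum.inr))
          ((perF M (bhKStepAt d (toSite r) Lc j)).submatrix (f ∘ Sum.inr) (f ∘ Sum.inl)))⁻¹
          = (perF M (coDressKBmAt (toSite r) Lc (KInvStep (d := d) Lc j))).submatrix f f
      ∧ ∀ p q : Idx M (Fib d), (p ∉ Set.range f ∨ q ∉ Set.range f) →
          perF M (coDressKBmAt (toSite r) Lc (KInvStep (d := d) Lc j)) p q = 0 := by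
  classical
  -- the live reading of `axEc`'s diagonal along `range f`
  have hP : ∀ p : Idx M (Fib d), axEc (toSite r) Lc p.1 p.1 p.2 p.2 = if p ∈ Set.range f then (1 : ℝ) else 0 := by
    intro p
    by_cases h : p ∈ Set.range f
    · rw [if_pos h]; exact (hlive p).2 h
    · rw [if_neg h]
      exact (axEc_diag_zero_or_one (toSite r) Lc (p.1 : Fin (d + 1) → ℤ) p.2).resolve_right fun h1 => h ((hlive p).1 h1)
  have hE : perF M (axEc (toSite r) Lc) = Matrix.diagonal fun p : Idx M (Fib d) => if p ∈ Set.range f then (1 : ℝ) else 0 := by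
    rw [perF_axEc]; congr 1; funext p; exact hP p
  obtain ⟨h1, h2, h3, h4⟩ := perF_rules_wall M hr hM j
  obtain ⟨hU, hI, hA⟩ := compress_of_rules_embedding (fun p : Idx M (Fib d) => p ∈ Set.range f) f hf (fun _ => Iff.rfl) hE h1 h2 h3 h4
  -- the presented live block IS `kOff`: its multiplier–multiplier corner vanishes
  have hkOff : (perF M (bhKStepAt d (toSite r) Lc j)).submatrix f f
      = kOff ((perF M (bhKStepAt d (toSite r) Lc j)).submatrix (f ∘ Sum.inl) (f ∘ Sum.inl))
          ((perF M (bhKStepAt d (toSite r) Lc j)).submatrix (f ∘ Sum.inl) (f ∘ Sum.inr))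
          ((perF M (bhKStepAt d (toSite r) Lc j)).submatrix (f ∘ Sum.inr) (f ∘ Sum.inl)) := by
    ext (i | a) (i' | a') <;> try rfl
    · obtain ⟨m, hm⟩ := hc a
      obtain ⟨m', hm'⟩ := hc a'
      rw [kOff, fromBlocks_apply₂₂, submatrix_apply, Matrix.zero_apply]
      exact perF_bhKStepAt_inr_inr (toSite r) Lc M j _ _ hm hm'
  rw [hkOff] at hU hI
  exact ⟨hU, hI, fun p q hpq => hA p q fun h => hpq.elim (fun hp => hp h.1) fun hq => hq h.2⟩

/-- **[folklore] (T-INV) ON THE TORUS, SLICED-KKT FORM — EVERY STEP `j`, ANY PRESENTATION.**  In the setting of `torus_kOff`, let moreover the `o`-slots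
be FIELD slots (`ho`) and let `g : t → Idx M (Fib d)` be ANY presentation of further fine bonds (the comb bonds; no hypothesis on `g`).  Read off
`M̂ := perF M (bhKStepAt d ρ Lc j)` the fine Hessian `[[Aoo, Aot],[Ato, Att]]` (`A_xy := M̂∘(x,y)`, `x,y ∈ {f inl, g}`) and the averaging rows
`[Co | Ct] := [M̂∘(f inr, f inl) | M̂∘(f inr, g)]`.  Then the road's SLICED KKT `kkt [[Aoo,Aot],[Ato,Att]] [[Co,Ct];[0,1]]` (comb coordinates
pinned, symmetric placement) has a unit determinant, and the live corner of its inverse is `+Â` on field rows, `−Â` on multiplier rows. -/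
theorem torus_sliced_kkt (hr : r ∈ box (d + 1) Lc) (hM : ∀ i, Lc ∣ M i) (j : ℕ)
    {o c t : Type*} [Fintype o] [Fintype c] [Fintype t] [DecidableEq o] [DecidableEq c] [DecidableEq t]
    (f : o ⊕ c → Idx M (Fib d)) (hf : Function.Injective f)
    (hlive : ∀ p : Idx M (Fib d), axEc (toSite r) Lc p.1 p.1 p.2 p.2 = 1 ↔ p ∈ Set.range f)
    (ho : ∀ i : o, ∃ α : Fin (d + 1), (f (Sum.inl i)).2 = Sum.inl α)
    (hc : ∀ a : c, ∃ m : Fin (d + 1), (f (Sum.inr a)).2 = Sum.inr m) (g : t → Idx M (Fib d)) :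
    IsUnit (kkt (fromBlocks ((perF M (bhKStepAt d (toSite r) Lc j)).submatrix (f ∘ Sum.inl) (f ∘ Sum.inl))
          ((perF M (bhKStepAt d (toSite r) Lc j)).submatrix (f ∘ Sum.inl) g)
          ((perF M (bhKStepAt d (toSite r) Lc j)).submatrix g (f ∘ Sum.inl))
          ((perF M (bhKStepAt d (toSite r) Lc j)).submatrix g g))
        (fromRows (fromCols ((perF M (bhKStepAt d (toSite r) Lc j)).submatrix (f ∘ Sum.inr) (f ∘ Sum.inl))
            ((perF M (bhKStepAt d (toSite r) Lc j)).submatrix (f ∘ Sum.inr) g))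
          (fromCols (0 : Matrix t o ℝ) (1 : Matrix t t ℝ)))).det
      ∧ ∀ x y : o ⊕ c,
        (kkt (fromBlocks ((perF M (bhKStepAt d (toSite r) Lc j)).submatrix (f ∘ Sum.inl) (f ∘ Sum.inl))
            ((perF M (bhKStepAt d (toSite r) Lc j)).submatrix (f ∘ Sum.inl) g)
            ((perF M (bhKStepAt d (toSite r) Lc j)).submatrix g (f ∘ Sum.inl))
            ((perF M (bhKStepAt d (toSite r) Lc j)).submatrix g g))
          (fromRows (fromCols ((perF M (bhKStepAt d (toSite r) Lc j)).submatrix (f ∘ Sum.inr) (f ∘ Sum.inl))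
              ((perF M (bhKStepAt d (toSite r) Lc j)).submatrix (f ∘ Sum.inr) g))
            (fromCols (0 : Matrix t o ℝ) (1 : Matrix t t ℝ))))⁻¹ (regroup o c t (Sum.inl x)) (regroup o c t (Sum.inl y))
          = Sum.elim (fun _ => (1 : ℝ)) (fun _ => -1) x * perF M (coDressKBmAt (toSite r) Lc (KInvStep (d := d) Lc j)) (f x) (f y) := by
  set Mh := perF M (bhKStepAt d (toSite r) Lc j) with hMh
  -- the top border of the torus bordered Hessian is `−Coᵀ`
  have hCof : Mh.submatrix (f ∘ Sum.inl) (f ∘ Sum.inr) = -(Mh.submatrix (f ∘ Sum.inr) (f ∘ Sum.inl))ᵀ := by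
    ext i a
    obtain ⟨α, hα⟩ := ho i
    obtain ⟨m, hm⟩ := hc a
    rw [neg_apply, transpose_apply, submatrix_apply, submatrix_apply]
    exact perF_bhKStepAt_inl_inr_eq_neg (toSite r) Lc M hM j _ _ hα hm
  obtain ⟨hU, hI, -⟩ := torus_kOff M hr hM j f hf hlive hc
  rw [hCof] at hU hI
  have hU' : IsUnit (kOff (Mh.submatrix (f ∘ Sum.inl) (f ∘ Sum.inl)) (Mh.submatrix (f ∘ Sum.inr) (f ∘ Sum.inl))ᵀ
      (Mh.submatrix (f ∘ Sum.inr) (f ∘ Sum.inl))).det := (isUnit_det_kOff_neg_left_iff _ _ _).1 hU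
  rw [kkt_fromRows_coordSlice_eq_kBig]
  refine ⟨(isUnit_det_kBig_iff _ _ _ _ _ _ _ _).2 hU', fun x y => ?_⟩
  rw [inv_kBig_apply _ _ _ _ _ _ _ _ hU' x y]
  -- `kOff A Coᵀ Co = kOff A (−(−Coᵀ)) Co`: the inverse is that of `kOff A (−Coᵀ) Co = Â∘f` with the multiplier rows negated
  have hI' := inv_kOff_neg_left_apply (Mh.submatrix (f ∘ Sum.inl) (f ∘ Sum.inl)) (-(Mh.submatrix (f ∘ Sum.inr) (f ∘ Sum.inl))ᵀ)
    (Mh.submatrix (f ∘ Sum.inr) (f ∘ Sum.inl)) hU x y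
  rw [neg_neg] at hI'
  rw [hI', hI, submatrix_apply]

/-- **[folklore] (T-INV) ON THE TORUS, SLOT-MAP FORM — the shape of binder `h1` of `NestedStepLawOneShot.secondVar_oneShot_nestedStepLaw`.**  Present the
fine torus bonds by an injective slot map `fν : ν → Idx M (Fib d)` into the FIELD slots and the coarse multipliers by an injective `fμ : μ → Idx M (Fib d)`
into the MULTIPLIER slots, and the comb by an injective map `cb : ρ₁ → ν` (the comb bond of each residual gauge parameter — leaf-06's `combBondT` read in
`ν`), so that the `axEc`-live set is `fν''(ν ∖ range cb) ∪ range fμ` (`hlive`).  With `H₀ := M̂.submatrix fν fν` (fine Hessian), `Q₁₀ := M̂.submatrix fμ fν`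
(averaging rows as they sit in `M̂`, i.e. with the level's border scale) and the comb-COORDINATE rows `τ₁ x b := [b = cb x]` (leaf-06's `combRowsT` read in
`ν`), the sliced KKT `kkt H₀ [Q₁₀; τ₁]` has a unit determinant — at every step `j`, on every box `M` with `Lc ∣ M_i`.  (Signed ∕ recombined comb rows:
`det_kkt_fromRows_mul_slice`; re-indexed conditions: `det_kkt_submatrix_equiv`; the inverse's live corner: `torus_sliced_kkt`.) -/
theorem torus_isUnit_det_kkt_of_slots (hr : r ∈ box (d + 1) Lc) (hM : ∀ i, Lc ∣ M i) (j : ℕ)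
    {ν μ ρ₁ : Type*} [Fintype ν] [Fintype μ] [Fintype ρ₁] [DecidableEq ν] [DecidableEq μ] [DecidableEq ρ₁]
    (fν : ν → Idx M (Fib d)) (fμ : μ → Idx M (Fib d)) (hfν : Function.Injective fν) (hfμ : Function.Injective fμ)
    (hν : ∀ b : ν, ∃ α : Fin (d + 1), (fν b).2 = Sum.inl α) (hμ : ∀ a : μ, ∃ m : Fin (d + 1), (fμ a).2 = Sum.inr m)
    (cb : ρ₁ → ν) (hcb : Function.Injective cb)
    (hlive : ∀ p : Idx M (Fib d),
      axEc (toSite r) Lc p.1 p.1 p.2 p.2 = 1 ↔ (∃ b, b ∉ Set.range cb ∧ fν b = p) ∨ p ∈ Set.range fμ) :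
    IsUnit (kkt ((perF M (bhKStepAt d (toSite r) Lc j)).submatrix fν fν)
      (fromRows ((perF M (bhKStepAt d (toSite r) Lc j)).submatrix fμ fν)
        (Matrix.of fun (x : ρ₁) (b : ν) => if b = cb x then (1 : ℝ) else 0))).det := by
  classical
  set Mh := perF M (bhKStepAt d (toSite r) Lc j) with hMh
  -- live presentation `f := fν off the comb ⊕ fμ`, dead presentation `g := fν ∘ cb`; then re-index `ν ≃ (ν ∖ range cb) ⊕ ρ₁`
  let f : {b : ν // b ∉ Set.range cb} ⊕ μ → Idx M (Fib d) := Sum.elim (fun b => fν b) fμ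
  let g : ρ₁ → Idx M (Fib d) := fun x => fν (cb x)
  have hf : Function.Injective f := by
    rintro (b | a) (b' | a') h
    · exact congrArg Sum.inl (Subtype.ext (hfν h))
    · obtain ⟨α, hα⟩ := hν b; obtain ⟨m, hm⟩ := hμ a'
      have e : (fν b).2 = (fμ a').2 := congrArg Prod.snd h; rw [hα, hm] at e; exact absurd e Sum.inl_ne_inr
    · obtain ⟨α, hα⟩ := hν b'; obtain ⟨m, hm⟩ := hμ a
      have e : (fμ a).2 = (fν b').2 := congrArg Prod.snd h; rw [hα, hm] at e; exact absurd e Sum.inr_ne_inl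
    · exact congrArg Sum.inr (hfμ h)
  have hlive' : ∀ p : Idx M (Fib d), axEc (toSite r) Lc p.1 p.1 p.2 p.2 = 1 ↔ p ∈ Set.range f := by
    intro p
    rw [hlive p]
    constructor
    · rintro (⟨b, hb, rfl⟩ | ⟨a, rfl⟩)
      exacts [⟨Sum.inl ⟨b, hb⟩, rfl⟩, ⟨Sum.inr a, rfl⟩]
    · rintro ⟨b | a, rfl⟩
      exacts [Or.inl ⟨b, b.2, rfl⟩, Or.inr ⟨a, rfl⟩]
  obtain ⟨hU, -⟩ := torus_sliced_kkt M hr hM j f hf hlive' (fun b => hν b) hμ g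
  let eν : {b : ν // b ∉ Set.range cb} ⊕ ρ₁ ≃ ν :=
    ((Equiv.sumComm _ _).trans (Equiv.sumCongr (Equiv.ofInjective cb hcb) (Equiv.refl _))).trans (Equiv.sumCompl fun b => b ∈ Set.range cb)
  have heν_inl : ∀ b : {b : ν // b ∉ Set.range cb}, eν (Sum.inl b) = b := fun b => rfl
  have heν_inr : ∀ x : ρ₁, eν (Sum.inr x) = cb x := fun x => rfl
  have hsys : kkt ((Mh.submatrix fν fν).submatrix eν eν)
        ((fromRows (Mh.submatrix fμ fν) (Matrix.of fun (x : ρ₁) (b : ν) => if b = cb x then (1 : ℝ) else 0)).submatrix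
          (Equiv.refl (μ ⊕ ρ₁)) eν)
      = kkt (fromBlocks (Mh.submatrix (f ∘ Sum.inl) (f ∘ Sum.inl)) (Mh.submatrix (f ∘ Sum.inl) g) (Mh.submatrix g (f ∘ Sum.inl))
            (Mh.submatrix g g))
          (fromRows (fromCols (Mh.submatrix (f ∘ Sum.inr) (f ∘ Sum.inl)) (Mh.submatrix (f ∘ Sum.inr) g))
            (fromCols (0 : Matrix ρ₁ {b : ν // b ∉ Set.range cb} ℝ) (1 : Matrix ρ₁ ρ₁ ℝ))) := by
    congr 1
    · ext (b | x) (b' | x') <;> rfl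
    · ext (a | x) (b' | x') <;> try rfl
      · simp only [submatrix_apply, Equiv.refl_apply, fromRows_apply_inr, fromCols_apply_inl, of_apply, heν_inl, Matrix.zero_apply]
        exact if_neg fun h : (b' : ν) = cb x => b'.2 ⟨x, h.symm⟩
      · simp only [submatrix_apply, Equiv.refl_apply, fromRows_apply_inr, fromCols_apply_inr, of_apply, heν_inr]
        by_cases h : x = x'
        · subst h; rw [if_pos rfl, Matrix.one_apply_eq]
        · rw [if_neg fun e => h (hcb e).symm, Matrix.one_apply_ne h]
  rw [← det_kkt_submatrix_equiv _ _ eν (Equiv.refl (μ ⊕ ρ₁)), hsys]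
  exact hU

end Dress

end Summit.QuantumFields.BalabanUV.Beta.FP.RelInvPeriodisedSliced

end
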